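import Literature.Analysis.UnboundedOperators.UnitaryRepSpectralMeasure
import HarnessLib

/-!
# The spectral measure of a set is the square of a seminorm; Minkowski's inequality for it

Topic `Analysis/UnboundedOperators`; namespace `Literature.Analysis.UnboundedOperators`. Proof file
(one definition with body, theorems) continuing `UnitaryRepSpectralMeasure`: for a unitary
representation `U` of the additive group of a finite-dimensional real vector space `V` and the
Stone–Bochner spectral measures `μ_v` (`⟪v, U_x v⟫ = ∫ exp(i B(ξ, x)) dμ_v(ξ)`), and ANY subset
`S ⊆ V`, the quantity `μ_v(S)` behaves like `‖P(S) v‖²` for the (here never constructed) spectral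
projection `P(S)` of the SNAG theorem (Folland (1995), Thm. 4.44; Riesz–Sz.-Nagy (1955), §109):

* `spectralMeasure_add_add_spectralMeasure_sub` — **parallelogram law**
  `μ_{v+w} + μ_{v-w} = 2 μ_v + 2 μ_w` (the two finite measures have the same Fourier transform:
  `⟪v+w, U(v+w)⟫ + ⟪v-w, U(v-w)⟫ = 2⟪v, U v⟫ + 2⟪w, U w⟫`; uniqueness
  `measure_eq_of_forall_integral_cexp_bilin_eq`); `spectralMeasure_smul` — `μ_{c v} = |c|² μ_v`;
* `spectralPolar` — the polarisation `β_S(v, w) = (μ_{v+w}(S) - μ_{v-w}(S)) / 4`, a bounded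
  symmetric positive semi-definite REAL bilinear form with `β_S(v, v) = μ_v(S)` (Jordan–von Neumann:
  additivity from the parallelogram law, real homogeneity from additivity and the bound
  `μ_v(S) ≤ ‖v‖²`), and the Cauchy–Schwarz inequality `β_S(v, w)² ≤ μ_v(S) μ_w(S)`;
* `spectralSeminorm U B hB S : Seminorm ℂ H`, `v ↦ μ_v(S)^{1/2}` — **the spectral measure of a set is
  the square of a seminorm**, dominated by the norm (`spectralSeminorm_le_norm`), `1`-Lipschitz;
* `spectralSeminorm_integral_le` — **Minkowski's inequality** `μ_{∫ F}(S)^{1/2} ≤ ∫ μ_{F(t)}(S)^{1/2} dt`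
  for a Bochner-integrable family of vectors (through the supporting functional `β_S(·, x)/p(x)`).

These are the abstract inputs of the "slab lemma" of the Mackey analysis of the mirabolic subgroup
(bounded spectral densities of smoothed vectors along an open orbit) on the route to
Jacquet–Shalika's Kirillov bound in ranks `≥ 3`
(`Literature.NumberTheory.Automorphic.JacquetShalika1981_archKirillovNorm_le`).

## References

* G. B. Folland, *A course in abstract harmonic analysis* (1995), §1.4 (Thm. 1.47: projection-valued
  measures, `μ_{v,v}(S) = ‖P(S)v‖²`), §4.4 Thm. 4.44 [Folland1995].
* P. Jordan, J. von Neumann, *On inner products in linear, metric spaces*, Ann. of Math. 36 (1935),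
  719–723 (additivity of the polarisation from the parallelogram law) [folklore].
-/

noncomputable section

open MeasureTheory Complex Filter Topology
open scoped InnerProductSpace ENNReal NNReal ComplexConjugate

namespace Literature.Analysis.UnboundedOperators

namespace UnitaryRep

variable {V : Type*} [NormedAddCommGroup V] [NormedSpace ℝ V] [FiniteDimensional ℝ V]
  [MeasurableSpace V] [BorelSpace V]
  {H : Type*} [NormedAddCommGroup H] [InnerProductSpace ℂ H] [CompleteSpace H]
  (U : UnitaryRep (Multiplicative V) H) (B : LinearMap.BilinForm ℝ V) (hB : B.Nondegenerate)

/-! ### 1. Parallelogram law and homogeneity of the spectral measures -/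

/-- A finite multiple of a spectral measure is a finite measure. [folklore] -/
private theorem isFiniteMeasure_smul_spectral (c : ℝ≥0∞) (hc : c ≠ ⊤) (v : H) :
    IsFiniteMeasure (c • U.spectralMeasure B hB v) :=
  ⟨by rw [Measure.smul_apply, smul_eq_mul]; exact ENNReal.mul_lt_top hc.lt_top (measure_lt_top _ _)⟩

/-- **Parallelogram law for spectral measures**: `μ_{v+w} + μ_{v-w} = 2 μ_v + 2 μ_w`. Both sides are
finite measures with Fourier transform `⟪v+w, U(v+w)⟫ + ⟪v-w, U(v-w)⟫ = 2⟪v, Uv⟫ + 2⟪w, Uw⟫`.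
[cite: Folland1995, Thm. 1.47 and Thm. 4.44] -/
theorem spectralMeasure_add_add_spectralMeasure_sub (v w : H) :
    U.spectralMeasure B hB (v + w) + U.spectralMeasure B hB (v - w) =
      (2 : ℝ≥0∞) • U.spectralMeasure B hB v + (2 : ℝ≥0∞) • U.spectralMeasure B hB w := by
  haveI := U.isFiniteMeasure_smul_spectral B hB 2 ENNReal.ofNat_ne_top v
  haveI := U.isFiniteMeasure_smul_spectral B hB 2 ENNReal.ofNat_ne_top w
  refine measure_eq_of_forall_integral_cexp_bilin_eq B hB fun x => ?_
  rw [integral_add_measure (integrable_cexp_bilin B _ x) (integrable_cexp_bilin B _ x),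
    integral_add_measure (integrable_cexp_bilin B _ x) (integrable_cexp_bilin B _ x),
    integral_smul_measure, integral_smul_measure,
    ← U.inner_map_eq_integral_spectralMeasure B hB, ← U.inner_map_eq_integral_spectralMeasure B hB,
    ← U.inner_map_eq_integral_spectralMeasure B hB, ← U.inner_map_eq_integral_spectralMeasure B hB]
  simp only [map_add, map_sub, inner_add_left, inner_add_right, inner_sub_left, inner_sub_right,
    ENNReal.toReal_ofNat, Complex.real_smul, Complex.ofReal_ofNat]
  ring

/-- **Homogeneity**: `μ_{c v} = |c|² μ_v`. [cite: Folland1995, Thm. 4.44] -/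
theorem spectralMeasure_smul (c : ℂ) (v : H) :
    U.spectralMeasure B hB (c • v) = ENNReal.ofReal (‖c‖ ^ 2) • U.spectralMeasure B hB v := by
  haveI := U.isFiniteMeasure_smul_spectral B hB (ENNReal.ofReal (‖c‖ ^ 2)) ENNReal.ofReal_ne_top v
  refine measure_eq_of_forall_integral_cexp_bilin_eq B hB fun x => ?_
  rw [integral_smul_measure, ENNReal.toReal_ofReal (by positivity), ← U.inner_map_eq_integral_spectralMeasure B hB,
    ← U.inner_map_eq_integral_spectralMeasure B hB, map_smul, inner_smul_left, inner_smul_right, ← mul_assoc,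
    Complex.real_smul, Complex.conj_mul', Complex.ofReal_pow]

/-- `μ_{-v} = μ_v`. [folklore] -/
theorem spectralMeasure_neg (v : H) : U.spectralMeasure B hB (-v) = U.spectralMeasure B hB v := by
  have h := U.spectralMeasure_smul B hB (-1) v
  rwa [neg_one_smul, norm_neg, norm_one, one_pow, ENNReal.ofReal_one, one_smul] at h

/-! ### 2. The real quadratic form `v ↦ μ_v(S)` of a set and its polarisation -/

variable (S : Set V)

/-- **Parallelogram law, setwise**: `μ_{v+w}(S) + μ_{v-w}(S) = 2 μ_v(S) + 2 μ_w(S)`. [folklore] -/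
theorem spectralMeasure_real_add_add_sub (v w : H) :
    (U.spectralMeasure B hB (v + w)).real S + (U.spectralMeasure B hB (v - w)).real S =
      2 * (U.spectralMeasure B hB v).real S + 2 * (U.spectralMeasure B hB w).real S := by
  have h := congrArg (fun μ : Measure V => (μ S).toReal) (U.spectralMeasure_add_add_spectralMeasure_sub B hB v w)
  simp only [Measure.add_apply, Measure.smul_apply, smul_eq_mul] at h
  rw [ENNReal.toReal_add (measure_ne_top _ _) (measure_ne_top _ _),
    ENNReal.toReal_add (ENNReal.mul_ne_top ENNReal.ofNat_ne_top (measure_ne_top _ _))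
      (ENNReal.mul_ne_top ENNReal.ofNat_ne_top (measure_ne_top _ _)),
    ENNReal.toReal_mul, ENNReal.toReal_mul, ENNReal.toReal_ofNat] at h
  exact h

/-- **Homogeneity, setwise**: `μ_{c v}(S) = |c|² μ_v(S)`. [folklore] -/
theorem spectralMeasure_real_smul (c : ℂ) (v : H) :
    (U.spectralMeasure B hB (c • v)).real S = ‖c‖ ^ 2 * (U.spectralMeasure B hB v).real S := by
  rw [Measure.real, U.spectralMeasure_smul B hB c v, Measure.smul_apply, smul_eq_mul, ENNReal.toReal_mul,
    ENNReal.toReal_ofReal (by positivity), Measure.real]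

/-- `μ_{-v}(S) = μ_v(S)`. [folklore] -/
theorem spectralMeasure_real_neg (v : H) :
    (U.spectralMeasure B hB (-v)).real S = (U.spectralMeasure B hB v).real S := by
  rw [U.spectralMeasure_neg B hB]

/-- `μ_0(S) = 0`. [folklore] -/
theorem spectralMeasure_real_zero : (U.spectralMeasure B hB (0 : H)).real S = 0 := by
  have h := U.spectralMeasure_real_smul B hB S (0 : ℂ) (0 : H)
  rwa [zero_smul, norm_zero, zero_pow two_ne_zero, zero_mul] at h

/-- **`μ_v(S) ≤ ‖v‖²`** (the total mass is `‖v‖²`). [folklore] -/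
theorem spectralMeasure_real_le_norm_sq (v : H) : (U.spectralMeasure B hB v).real S ≤ ‖v‖ ^ 2 := by
  rw [← U.spectralMeasure_real_univ B hB v]
  exact measureReal_mono (Set.subset_univ S)

/-- **The polarisation** `β_S(v, w) = (μ_{v+w}(S) - μ_{v-w}(S)) / 4` of the quadratic form `v ↦ μ_v(S)`.
[cite: Folland1995, Thm. 1.47] -/
def spectralPolar (v w : H) : ℝ :=
  ((U.spectralMeasure B hB (v + w)).real S - (U.spectralMeasure B hB (v - w)).real S) / 4

/-- `β_S(v, v) = μ_v(S)`. [folklore] -/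
theorem spectralPolar_self (v : H) : U.spectralPolar B hB S v v = (U.spectralMeasure B hB v).real S := by
  rw [spectralPolar, sub_self, U.spectralMeasure_real_zero B hB, sub_zero, ← two_smul ℂ v,
    U.spectralMeasure_real_smul B hB, Complex.norm_ofNat]
  ring

/-- `β_S` is symmetric. [folklore] -/
theorem spectralPolar_comm (v w : H) : U.spectralPolar B hB S v w = U.spectralPolar B hB S w v := by
  rw [spectralPolar, spectralPolar, add_comm v w, ← neg_sub w v, U.spectralMeasure_real_neg B hB]

/-- `β_S(0, w) = 0`. [folklore] -/
theorem spectralPolar_zero_left (w : H) : U.spectralPolar B hB S 0 w = 0 := by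
  rw [spectralPolar, zero_add, zero_sub, U.spectralMeasure_real_neg B hB, sub_self, zero_div]

/-- **Additivity of the polarisation** (Jordan–von Neumann): `β_S(v + v', w) = β_S(v, w) + β_S(v', w)`.
From the parallelogram law: `φ(v + v', 2w) = 2φ(v, w) + 2φ(v', w)` for `φ(v, w) = μ_{v+w} - μ_{v-w}`,
and `φ(u, 2w) = 2φ(u, w)`. [folklore] -/
theorem spectralPolar_add_left (v v' w : H) :
    U.spectralPolar B hB S (v + v') w = U.spectralPolar B hB S v w + U.spectralPolar B hB S v' w := by
  -- `φ(a + b, 2w) = 2 φ(a, w) + 2 φ(b, w)` for all `a, b`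
  have key : ∀ a b : H,
      (U.spectralMeasure B hB (a + b + (2 : ℂ) • w)).real S - (U.spectralMeasure B hB (a + b - (2 : ℂ) • w)).real S =
        2 * ((U.spectralMeasure B hB (a + w)).real S - (U.spectralMeasure B hB (a - w)).real S) +
        2 * ((U.spectralMeasure B hB (b + w)).real S - (U.spectralMeasure B hB (b - w)).real S) := by
    intro a b
    have h1 := U.spectralMeasure_real_add_add_sub B hB S (a + w) (b + w)
    have h2 := U.spectralMeasure_real_add_add_sub B hB S (a - w) (b - w)
    have e1 : a + w + (b + w) = a + b + (2 : ℂ) • w := by rw [two_smul]; abel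
    have e2 : a + w - (b + w) = a - b := by abel
    have e3 : a - w + (b - w) = a + b - (2 : ℂ) • w := by rw [two_smul]; abel
    have e4 : a - w - (b - w) = a - b := by abel
    rw [e1, e2] at h1
    rw [e3, e4] at h2
    linarith
  have h := key v v'
  have h0 := key (v + v') 0
  rw [add_zero, zero_add, zero_sub, U.spectralMeasure_real_neg B hB, sub_self, mul_zero, add_zero] at h0
  simp only [spectralPolar]
  linarith

/-- **Boundedness of the polarisation**: `|β_S(v, w)| ≤ (‖v‖² + ‖w‖²) / 2`. [folklore] -/
theorem abs_spectralPolar_le (v w : H) : |U.spectralPolar B hB S v w| ≤ (‖v‖ ^ 2 + ‖w‖ ^ 2) / 2 := by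
  have h1 := U.spectralMeasure_real_le_norm_sq B hB S (v + w)
  have h2 := U.spectralMeasure_real_le_norm_sq B hB S (v - w)
  have h3 : 0 ≤ (U.spectralMeasure B hB (v + w)).real S := measureReal_nonneg
  have h4 : 0 ≤ (U.spectralMeasure B hB (v - w)).real S := measureReal_nonneg
  have hpar : ‖v + w‖ ^ 2 + ‖v - w‖ ^ 2 = 2 * (‖v‖ ^ 2 + ‖w‖ ^ 2) :=
    parallelogram_law_with_norm ℂ v w
  rw [spectralPolar, abs_le]
  constructor <;> nlinarith

/-- The polarisation as an additive map in the first variable. [folklore] -/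
def spectralPolarAddHom (w : H) : H →+ ℝ where
  toFun v := U.spectralPolar B hB S v w
  map_zero' := U.spectralPolar_zero_left B hB S w
  map_add' v v' := U.spectralPolar_add_left B hB S v v' w

/-- **Continuity of `v ↦ β_S(v, w)`**: an additive map bounded on the unit ball is continuous
(`|β_S(v, w)| ≤ M / n` for `‖v‖ ≤ 1/n`, `n β(v) = β(n v)`). [folklore] -/
theorem continuous_spectralPolarAddHom (w : H) : Continuous (U.spectralPolarAddHom B hB S w) := by
  set f := U.spectralPolarAddHom B hB S w with hf
  set M : ℝ := (1 + ‖w‖ ^ 2) / 2 with hM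
  have hM0 : 0 ≤ M := by positivity
  have hball : ∀ v : H, ‖v‖ ≤ 1 → |f v| ≤ M := by
    intro v hv
    refine (U.abs_spectralPolar_le B hB S v w).trans ?_
    have : ‖v‖ ^ 2 ≤ 1 := by nlinarith [norm_nonneg v]
    rw [hM]; linarith
  -- `|f v| ≤ M / (n+1)` when `‖v‖ ≤ 1 / (n+1)`
  have hsmall : ∀ (n : ℕ) (v : H), ‖v‖ ≤ 1 / (n + 1 : ℝ) → |f v| ≤ M / (n + 1 : ℝ) := by
    intro n v hv
    have hn : (0 : ℝ) < n + 1 := by positivity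
    have hnv : ‖((n + 1 : ℝ)) • v‖ ≤ 1 := by
      rw [norm_smul, Real.norm_of_nonneg hn.le]
      calc (n + 1 : ℝ) * ‖v‖ ≤ (n + 1 : ℝ) * (1 / (n + 1 : ℝ)) := mul_le_mul_of_nonneg_left hv hn.le
        _ = 1 := by field_simp
    have h := hball _ hnv
    have hcast : ((n + 1 : ℝ)) • v = ((n + 1 : ℕ)) • v := by
      rw [← Nat.cast_smul_eq_nsmul ℝ, Nat.cast_add, Nat.cast_one]
    rw [hcast, map_nsmul, nsmul_eq_mul] at h
    push_cast at h
    rw [abs_mul, abs_of_pos hn] at h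
    rw [le_div_iff₀ hn, mul_comm]
    exact h
  -- continuity at `0`, then everywhere by additivity
  have h0 : ContinuousAt f 0 := by
    rw [ContinuousAt, map_zero, Metric.tendsto_nhds_nhds]
    intro ε hε
    obtain ⟨n, hn⟩ := exists_nat_gt (M / ε)
    have hn1 : (0 : ℝ) < n + 1 := by positivity
    refine ⟨1 / (n + 1 : ℝ), by positivity, fun v hv => ?_⟩
    rw [dist_zero_right] at hv
    rw [dist_zero_right, Real.norm_eq_abs]
    calc |f v| ≤ M / (n + 1 : ℝ) := hsmall n v hv.le
      _ < ε := by
          rw [div_lt_iff₀ hn1]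
          have : M / ε < n + 1 := hn.trans (by linarith)
          rwa [div_lt_iff₀ hε, mul_comm] at this
  exact continuous_of_continuousAt_zero f h0

/-- **`v ↦ β_S(v, w)` as a continuous REAL-linear functional** (`AddMonoidHom.toRealLinearMap`).
[folklore] -/
def spectralPolarCLM (w : H) : H →L[ℝ] ℝ :=
  (U.spectralPolarAddHom B hB S w).toRealLinearMap (U.continuous_spectralPolarAddHom B hB S w)

/-- Unfolding of `spectralPolarCLM`. [folklore] -/
@[simp] theorem spectralPolarCLM_apply (w v : H) : U.spectralPolarCLM B hB S w v = U.spectralPolar B hB S v w := rfl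

/-- Real homogeneity of the polarisation in the first variable. [folklore] -/
theorem spectralPolar_smul_left (t : ℝ) (v w : H) :
    U.spectralPolar B hB S (t • v) w = t * U.spectralPolar B hB S v w := by
  have h := (U.spectralPolarCLM B hB S w).map_smul t v
  simpa only [spectralPolarCLM_apply, smul_eq_mul] using h

/-- Real homogeneity in the second variable. [folklore] -/
theorem spectralPolar_smul_right (t : ℝ) (v w : H) :
    U.spectralPolar B hB S v (t • w) = t * U.spectralPolar B hB S v w := by
  rw [U.spectralPolar_comm B hB S, U.spectralPolar_smul_left B hB S, U.spectralPolar_comm B hB S]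

/-- Additivity in the second variable. [folklore] -/
theorem spectralPolar_add_right (v w w' : H) :
    U.spectralPolar B hB S v (w + w') = U.spectralPolar B hB S v w + U.spectralPolar B hB S v w' := by
  rw [U.spectralPolar_comm B hB S, U.spectralPolar_add_left B hB S, U.spectralPolar_comm B hB S w,
    U.spectralPolar_comm B hB S w']

/-- **Expansion of the quadratic form along a real line**:
`μ_{v + t w}(S) = μ_v(S) + 2 t β_S(v, w) + t² μ_w(S)`. [folklore] -/
theorem spectralMeasure_real_add_smul (v w : H) (t : ℝ) :
    (U.spectralMeasure B hB (v + t • w)).real S =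
      (U.spectralMeasure B hB v).real S + 2 * t * U.spectralPolar B hB S v w + t ^ 2 * (U.spectralMeasure B hB w).real S := by
  rw [← U.spectralPolar_self B hB S, U.spectralPolar_add_left B hB S, U.spectralPolar_add_right B hB S,
    U.spectralPolar_add_right B hB S, U.spectralPolar_smul_left B hB S, U.spectralPolar_smul_left B hB S,
    U.spectralPolar_smul_right B hB S, U.spectralPolar_smul_right B hB S, U.spectralPolar_self B hB S,
    U.spectralPolar_self B hB S, U.spectralPolar_comm B hB S w v]
  ring

/-- **Cauchy–Schwarz for the polarisation**: `β_S(v, w)² ≤ μ_v(S) μ_w(S)` (the discriminant of the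
non-negative quadratic `t ↦ μ_{v + t w}(S)`). [cite: Folland1995, Thm. 1.47] -/
theorem spectralPolar_sq_le (v w : H) :
    U.spectralPolar B hB S v w ^ 2 ≤ (U.spectralMeasure B hB v).real S * (U.spectralMeasure B hB w).real S := by
  have hq : ∀ t : ℝ, 0 ≤ (U.spectralMeasure B hB w).real S * (t * t) + 2 * U.spectralPolar B hB S v w * t +
      (U.spectralMeasure B hB v).real S := by
    intro t
    have h := U.spectralMeasure_real_add_smul B hB S v w t
    have h0 : 0 ≤ (U.spectralMeasure B hB (v + t • w)).real S := measureReal_nonneg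
    nlinarith
  have hd := discrim_le_zero hq
  rw [discrim] at hd
  nlinarith

/-! ### 3. The seminorm `v ↦ μ_v(S)^{1/2}` -/

/-- **Subadditivity of `v ↦ μ_v(S)^{1/2}`.** [cite: Folland1995, Thm. 1.47] -/
theorem sqrt_spectralMeasure_real_add_le (v w : H) :
    Real.sqrt ((U.spectralMeasure B hB (v + w)).real S) ≤
      Real.sqrt ((U.spectralMeasure B hB v).real S) + Real.sqrt ((U.spectralMeasure B hB w).real S) := by
  set a := (U.spectralMeasure B hB v).real S
  set b := (U.spectralMeasure B hB w).real S
  have ha : 0 ≤ a := measureReal_nonneg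
  have hb : 0 ≤ b := measureReal_nonneg
  have hexp : (U.spectralMeasure B hB (v + w)).real S = a + 2 * U.spectralPolar B hB S v w + b := by
    have h := U.spectralMeasure_real_add_smul B hB S v w 1
    rw [one_smul] at h
    rw [h]; ring
  have hcs : U.spectralPolar B hB S v w ≤ Real.sqrt a * Real.sqrt b := by
    rw [← Real.sqrt_mul ha]
    refine Real.le_sqrt_of_sq_le ?_
    exact U.spectralPolar_sq_le B hB S v w
  rw [hexp]
  refine Real.sqrt_le_iff.2 ⟨by positivity, ?_⟩
  nlinarith [Real.sq_sqrt ha, Real.sq_sqrt hb, Real.sqrt_nonneg a, Real.sqrt_nonneg b]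

/-- **The spectral measure of a set is the square of a seminorm**: `v ↦ μ_v(S)^{1/2}` is a seminorm
on `H` (subadditive by Cauchy–Schwarz for the polarisation, absolutely homogeneous by
`μ_{cv} = |c|² μ_v`). It is `‖P(S) v‖` for the spectral projection of the SNAG theorem, which is
not needed here. [cite: Folland1995, Thm. 1.47 and Thm. 4.44] -/
def spectralSeminorm : Seminorm ℂ H :=
  Seminorm.of (fun v => Real.sqrt ((U.spectralMeasure B hB v).real S))
    (fun v w => U.sqrt_spectralMeasure_real_add_le B hB S v w)
    (fun c v => by
      rw [U.spectralMeasure_real_smul B hB S, Real.sqrt_mul (by positivity), Real.sqrt_sq (norm_nonneg c)])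

/-- Unfolding of `spectralSeminorm`. [folklore] -/
theorem spectralSeminorm_apply (v : H) :
    U.spectralSeminorm B hB S v = Real.sqrt ((U.spectralMeasure B hB v).real S) := rfl

/-- `(μ_v(S)^{1/2})² = μ_v(S)`. [folklore] -/
theorem spectralSeminorm_sq (v : H) : U.spectralSeminorm B hB S v ^ 2 = (U.spectralMeasure B hB v).real S := by
  rw [spectralSeminorm_apply, Real.sq_sqrt measureReal_nonneg]

/-- **The spectral seminorm is dominated by the norm**: `μ_v(S)^{1/2} ≤ ‖v‖`. [folklore] -/
theorem spectralSeminorm_le_norm (v : H) : U.spectralSeminorm B hB S v ≤ ‖v‖ := by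
  rw [spectralSeminorm_apply]
  refine Real.sqrt_le_iff.2 ⟨norm_nonneg v, ?_⟩
  exact U.spectralMeasure_real_le_norm_sq B hB S v

/-- The spectral seminorm is `1`-Lipschitz, in particular continuous. [folklore] -/
theorem lipschitzWith_spectralSeminorm : LipschitzWith 1 (U.spectralSeminorm B hB S) := by
  refine LipschitzWith.of_le_add fun v w => ?_
  calc U.spectralSeminorm B hB S v = U.spectralSeminorm B hB S (w + (v - w)) := by rw [add_sub_cancel]
    _ ≤ U.spectralSeminorm B hB S w + U.spectralSeminorm B hB S (v - w) := map_add_le_add _ _ _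
    _ ≤ U.spectralSeminorm B hB S w + ‖v - w‖ := by
        gcongr
        exact U.spectralSeminorm_le_norm B hB S (v - w)
    _ = U.spectralSeminorm B hB S w + dist v w := by rw [dist_eq_norm]

/-- Continuity of the spectral seminorm. [folklore] -/
theorem continuous_spectralSeminorm : Continuous (U.spectralSeminorm B hB S) :=
  (U.lipschitzWith_spectralSeminorm B hB S).continuous

/-- **The supporting functional**: `|β_S(v, x)| ≤ μ_v(S)^{1/2} μ_x(S)^{1/2}`. [folklore] -/
theorem abs_spectralPolar_le_mul (v x : H) :
    |U.spectralPolar B hB S v x| ≤ U.spectralSeminorm B hB S v * U.spectralSeminorm B hB S x := by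
  rw [spectralSeminorm_apply, spectralSeminorm_apply, ← Real.sqrt_mul measureReal_nonneg, ← Real.sqrt_sq_eq_abs]
  exact Real.sqrt_le_sqrt (U.spectralPolar_sq_le B hB S v x)

/-! ### 4. Minkowski's inequality for Bochner integrals of vectors -/

/-- **Minkowski's inequality for the spectral seminorm**: for a Bochner-integrable family of vectors
`F`, `μ_{∫ F}(S)^{1/2} ≤ ∫ μ_{F(t)}(S)^{1/2} dt`. Proof: with `x = ∫ F` and `p = μ_·(S)^{1/2}`, the real
linear functional `l = β_S(·, x) / p(x)` satisfies `l ≤ p` (Cauchy–Schwarz) and `l(x) = p(x)`, so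
`p(x) = ∫ l ∘ F ≤ ∫ p ∘ F`. [cite: Folland1995, Thm. 1.47] -/
theorem spectralSeminorm_integral_le {α : Type*} [MeasurableSpace α] {ν : Measure α} {F : α → H}
    (hF : Integrable F ν) :
    U.spectralSeminorm B hB S (∫ t, F t ∂ν) ≤ ∫ t, U.spectralSeminorm B hB S (F t) ∂ν := by
  set p := U.spectralSeminorm B hB S with hp
  set x := ∫ t, F t ∂ν with hx
  have hint : Integrable (fun t => p (F t)) ν := by
    refine hF.norm.mono' ((U.continuous_spectralSeminorm B hB S).comp_aestronglyMeasurable hF.1) ?_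
    exact ae_of_all _ fun t => by
      rw [Real.norm_of_nonneg (apply_nonneg p _)]
      exact U.spectralSeminorm_le_norm B hB S _
  by_cases hx0 : p x = 0
  · rw [hx0]
    exact integral_nonneg fun t => apply_nonneg p _
  have hxpos : 0 < p x := lt_of_le_of_ne (apply_nonneg p x) (Ne.symm hx0)
  -- the supporting functional
  set l : H →L[ℝ] ℝ := (p x)⁻¹ • U.spectralPolarCLM B hB S x with hl
  have hl_le : ∀ v, l v ≤ p v := by
    intro v
    change (p x)⁻¹ * U.spectralPolar B hB S v x ≤ p v
    have h := (le_abs_self _).trans (U.abs_spectralPolar_le_mul B hB S v x)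
    calc (p x)⁻¹ * U.spectralPolar B hB S v x ≤ (p x)⁻¹ * (p v * p x) :=
          mul_le_mul_of_nonneg_left h (inv_nonneg.2 hxpos.le)
      _ = p v := by field_simp
  have hlx : l x = p x := by
    change (p x)⁻¹ * U.spectralPolar B hB S x x = p x
    rw [U.spectralPolar_self B hB S, ← U.spectralSeminorm_sq B hB S, ← hp, sq, ← mul_assoc, inv_mul_cancel₀ hx0,
      one_mul]
  calc p x = l x := hlx.symm
    _ = ∫ t, l (F t) ∂ν := by rw [hx, ← ContinuousLinearMap.integral_comp_comm l hF]
    _ ≤ ∫ t, p (F t) ∂ν := integral_mono (l.integrable_comp hF) hint fun t => hl_le (F t)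

end UnitaryRep

end Literature.Analysis.UnboundedOperators

end
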